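/-
Copyright (c) 2026 the pub-hodgecm-mathlib formalisation cell (harness21).  Prover seat hodgecm-mathlib-LH7-p04 (g12), 2026-09-03.
Road M6 → F3 «TOT-Λ BY OVER-ORDERS» (LEAD F0P3a-plan (g16) T14-66; sigsheets SIG-F3-5 v1 6925585c ∕ SIG-F3-5b-III v1 5a0aa3cf, F3-5 pen by (α)-lineage), brick F3-5b-III-α «THE TREE-CURRENCY COUNT».
-/
import Literature.NumberTheory.Automorphic.OverOrderStrataTotalClosed            -- ★ F3-5b-II (this seat): `ncard_setOf_selfDual_stable_eq_phiTHn ∕ _phiTHprimen`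
import Literature.NumberTheory.Automorphic.SelfDualProductOrderGateSufficiency     -- ★ (c10b-S3-A) (F0P3a-p02 (g27)) p853181: `exists_selfDual_cyclicOver_map_of_even_log`, `valued_v_eq_of_valuation_eq`
import Literature.NumberTheory.Automorphic.SelfDualLatticeSpanCurrencyBridge       -- ★ (c2) (LH10-p01 (g10)) p853006: `ncard_setOf_isSelfDualLattice_map_le_eq_ncard_setOf_span_map_le`
import HarnessLib

/-!
# The self-dual lattices stable under a type-(2) element, counted in the lattice-TREE currency: `#{M | self-dual, τM ⊆ M} = Φ(t) ∕ Φ′(t″)` over a ⋆-stable glued type-(2) order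

Topic `NumberTheory/Automorphic`; namespace `Literature.NumberTheory.Automorphic`.  THEOREMS ONLY (no definition, no instance, no notation, no named fact, no `sorry`).
Cell `pub/hodgecm-mathlib` (D-0151), crux H413 = `stmt-HodgeConjecture-24833`; road M6 → F3 «TOT-Λ by over-orders», brick **F3-5b-III-α** (SIG-F3-5b-III v1 §1 rows (S1), `hgate₀`,
`hlaw∕m∕hm`, `cF`): ★ F3-5b-II's SPAN-currency closed forms with (i) the product-order witness `hgate₀` DISCHARGED by ★ (c10b-S3-A), (ii) the lawful row `hlaw`, the order `m` and the
finite-order representative `c_F` DERIVED from ★ (c6)∕FILE D's level disjunction of the type-(2) order `𝒪_E[x_R] = G(N, n, ιO y)`, and (iii) the count MOVED to the lattice-TREE currency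
(`Valued.integer`, `IsSelfDualLattice σ ϖ J`) of ★ (W1) `SelfDualLatticeFixOrderOnly` by ★ (c2).  What remains as BINDERS: the abstract valued∕integral frame (★ 5b-II's letters + the
`Valued` letters of ★ (c10b-S3-A): `hjv hθv hϖv hnormK`, unique field coordinates `hcoordK`), the form's self-dual root and transitivity (`hL₀ htrans`, ★ (c2)'s letters), the PARITY
GATE `hgate` at deep unitary generators (★ 5b-I's binder; discharged at a block frame by ★ (c8)-cor `gate_at_generator_uniform ∕ _wildUnit` in F3-5b-III-β), the class token, and
the type-(2) order in ★ FILE D `exists_typeTwoOrder_of_eisensteinData`'s OUTPUT shape (`xR hxR`, `y`, `hR`, `hlvl`) — so that F3-5b-III-β ∕ F5 feed it by ONE `obtain` from the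
(W1) Eisenstein data, at the unitary pair and (★-to-be FILE D′) at its shifts.
HONEST LABEL: HC_CM is proved only modulo the 2 remaining named inputs (hLiu418 24832, h413 24833) until rung 0 closes; assembly of ★ bricks, asserts nothing printed; count-neutral
(pays no organ; zero label movement until F5 ★ and a desk-priced rider).

* §1 `exists_rep_exact_order` (a DVR class has a representative of exact finite order), `exists_lawful_rep_of_level` (FILE D's level disjunction ⇒ `c_F`, `hlaw`, `m`, `hm`, `hR`).
* §2 **`ncard_isSelfDualLattice_stable_eq_phiTHn`** (class I), **`ncard_isSelfDualLattice_stable_eq_phiTHprimen`** (class II).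

## References
* [Rogawski1990] J. D. Rogawski, *Automorphic Representations of Unitary Groups in Three Variables*, Ann. of Math. Stud. 123 (1990): §4.9 Lemma 4.9.3 p. 56, Prop. 4.9.1 (b) p. 55.
* [Flicker1998UnitaryFL] Y. Z. Flicker, *Elementary proof of the fundamental lemma for a unitary group*, Canad. J. Math. 50 (1998): Props. 7, 11, 16–17, Theorem 18 p. 97.
* [Jacobowitz1962] R. Jacobowitz, *Hermitian forms over local fields*, Amer. J. Math. 84 (1962): §7.
* [Kottwitz1986BaseChangeUnits] R. E. Kottwitz, *Base change for unit elements of Hecke algebras*, Compositio Math. 60 (1986): §1 pp. 240–241 (fixed vertices = stable self-dual lattices).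
* [SerreLocalFields1979] J.-P. Serre, *Local Fields*, GTM 67 (1979): Ch. I §6 (orders of elements in a DVR).
-/

set_option autoImplicit false

noncomputable section

open Matrix Polynomial
open scoped MatrixGroups ValuativeRel Pointwise WithZero

namespace Literature.NumberTheory.Automorphic

open Literature.NumberTheory.Automorphic.UnitaryGroup ValuativeRel Literature.NumberTheory.Rogawski1990.Flicker1998
  Literature.NumberTheory.Automorphic.UnitaryLatticeTree Literature.NumberTheory.Automorphic.HermitianLattice

/-! ## §1 Representatives of finite order; the lawful row of a level -/

section Reps

variable {F : Type*} [Field F] [ValuativeRel F] {ϖF : F} (hϖF : IsUniformizingElement ϖF)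

include hϖF in
/-- **A REPRESENTATIVE OF EXACT FINITE ORDER.**  In a DVR every class `c mod π^n` has a representative `c′ ≡ c (π^n)` of EXACT finite order `m ≤ n` (`∀ j, c′ ∈ (π^j) ↔ j ≤ m`):
`c′ := π^n` if `c ∈ (π^n)`, else `c′ := c` (`c = ε·π^m`, `m < n`). [cite: SerreLocalFields1979, Ch. I §6] -/
theorem exists_rep_exact_order [IsDiscreteValuationRing 𝒪[F]] (n : ℕ) (c : 𝒪[F]) :
    ∃ (c' : 𝒪[F]) (m : ℕ), c' - c ∈ Ideal.span ({(⟨ϖF, hϖF.mem⟩ : 𝒪[F]) ^ n} : Set 𝒪[F]) ∧ m ≤ n ∧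
      (∀ j : ℕ, c' ∈ Ideal.span ({(⟨ϖF, hϖF.mem⟩ : 𝒪[F]) ^ j} : Set 𝒪[F]) ↔ j ≤ m) := by
  classical
  set π : 𝒪[F] := ⟨ϖF, hϖF.mem⟩ with hπ
  have hπirr : Irreducible π := hϖF.irreducible_coe
  have hmem_iff : ∀ (a j : ℕ), π ^ a ∈ Ideal.span ({π ^ j} : Set 𝒪[F]) ↔ j ≤ a := fun a j => by
    rw [Ideal.mem_span_singleton]; exact hϖF.coe_pow_dvd_pow_iff
  by_cases hc : c ∈ Ideal.span ({π ^ n} : Set 𝒪[F])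
  · exact ⟨π ^ n, n, Ideal.sub_mem _ (Ideal.mem_span_singleton_self _) hc, le_rfl, fun j => hmem_iff n j⟩
  · have hc0 : c ≠ 0 := fun h => hc (by rw [h]; exact Ideal.zero_mem _)
    obtain ⟨m, u, hcu⟩ := IsDiscreteValuationRing.eq_unit_mul_pow_irreducible hc0 hπirr
    refine ⟨c, m, by rw [sub_self]; exact Ideal.zero_mem _, ?_, fun j => ?_⟩
    · by_contra hmn
      exact hc (by rw [hcu]; exact Ideal.mul_mem_left _ _ ((hmem_iff m n).2 (by omega)))
    · rw [hcu, Ideal.unit_mul_mem_iff_mem _ u.isUnit]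
      exact hmem_iff m j

variable {E : Type*} [Field E] [ValuativeRel E] (ιO : 𝒪[F] →+* 𝒪[E]) {ϖ : E} (hϖ : IsUniformizingElement ϖ) (hιϖ : ιO ⟨ϖF, hϖF.mem⟩ = ⟨ϖ, hϖ.mem⟩)
  {O₁ : Type*} [CommRing O₁] (j : 𝒪[E] →+* O₁) (θ : O₁) (hcoord : ∀ z : O₁, ∃! bc : 𝒪[E] × 𝒪[E], z = j bc.1 + j bc.2 * θ)

include hιϖ hcoord in
/-- **THE LAWFUL ROW OF A LEVEL.**  From ★ FILE D's level disjunction for the hermitian character `ιO y` of `𝒪_E[x_R] = G(N, n, ιO y)` — `n = 2N+1 ∧ y ∈ (ϖ_F^{N+1})`, or `n = 2M`,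
`M ≤ N`, `y ∈ (ϖ_F^M) ∖ (ϖ_F^{M+1})` — a representative `c_F ≡ y (ϖ_F^n)` of exact finite order `m` (§1) on a LAWFUL row `n = 0 ∨ (n = 2m ∧ 1 ≤ m ≤ N) ∨ (n = 2N+1 ∧ N+1 ≤ m)`,
with the SAME glued order `G(N, n, ιO c_F) = G(N, n, ιO y)` (★ F3-1a `glued_eq_glued_iff`). [cite: Rogawski1990, §4.9 Prop. 4.9.1 (b) p. 55] [cite: SerreLocalFields1979, Ch. I §6] -/
theorem exists_lawful_rep_of_level [IsDiscreteValuationRing 𝒪[F]] {N n : ℕ} {y : 𝒪[F]}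
    (hlvl : (n = 2 * N + 1 ∧ y ∈ Ideal.span {(⟨ϖF, hϖF.mem⟩ : 𝒪[F]) ^ (N + 1)}) ∨
      ∃ M : ℕ, M ≤ N ∧ n = 2 * M ∧ y ∈ Ideal.span {(⟨ϖF, hϖF.mem⟩ : 𝒪[F]) ^ M} ∧ y ∉ Ideal.span {(⟨ϖF, hϖF.mem⟩ : 𝒪[F]) ^ (M + 1)}) :
    ∃ (cF : 𝒪[F]) (m : ℕ),
      {z : 𝒪[E] × O₁ | ∃ b₀ c₀ : 𝒪[E], z.2 = j b₀ + j c₀ * (j ((⟨ϖ, hϖ.mem⟩ : 𝒪[E]) ^ N) * θ) ∧ z.1 - (b₀ + c₀ * ιO y) ∈ Ideal.span {(⟨ϖ, hϖ.mem⟩ : 𝒪[E]) ^ n}} =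
        {z : 𝒪[E] × O₁ | ∃ b₀ c₀ : 𝒪[E], z.2 = j b₀ + j c₀ * (j ((⟨ϖ, hϖ.mem⟩ : 𝒪[E]) ^ N) * θ) ∧ z.1 - (b₀ + c₀ * ιO cF) ∈ Ideal.span {(⟨ϖ, hϖ.mem⟩ : 𝒪[E]) ^ n}} ∧
      (n = 0 ∨ (n = 2 * m ∧ 1 ≤ m ∧ m ≤ N) ∨ (n = 2 * N + 1 ∧ N + 1 ≤ m)) ∧
      (∀ j' : ℕ, cF ∈ Ideal.span ({(⟨ϖF, hϖF.mem⟩ : 𝒪[F]) ^ j'} : Set 𝒪[F]) ↔ j' ≤ m) := by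
  set πF : 𝒪[F] := ⟨ϖF, hϖF.mem⟩ with hπF
  set π : 𝒪[E] := ⟨ϖ, hϖ.mem⟩ with hπdef
  have hle : ∀ {a b : ℕ}, b ≤ a → Ideal.span ({πF ^ a} : Set 𝒪[F]) ≤ Ideal.span {πF ^ b} := fun {a b} h =>
    Ideal.span_singleton_le_span_singleton.2 (pow_dvd_pow πF h)
  -- the same glued order for congruent representatives
  have hG : ∀ cF : 𝒪[F], cF - y ∈ Ideal.span ({πF ^ n} : Set 𝒪[F]) →
      {z : 𝒪[E] × O₁ | ∃ b₀ c₀ : 𝒪[E], z.2 = j b₀ + j c₀ * (j (π ^ N) * θ) ∧ z.1 - (b₀ + c₀ * ιO y) ∈ Ideal.span {π ^ n}} =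
        {z : 𝒪[E] × O₁ | ∃ b₀ c₀ : 𝒪[E], z.2 = j b₀ + j c₀ * (j (π ^ N) * θ) ∧ z.1 - (b₀ + c₀ * ιO cF) ∈ Ideal.span {π ^ n}} := by
    intro cF hcy
    refine (glued_eq_glued_iff j θ π hcoord N n (ιO y) (ιO cF) hϖ.coe_ne_zero).2 ?_
    rw [← neg_sub, ← map_sub]
    exact (Ideal.span ({π ^ n} : Set 𝒪[E])).neg_mem (map_mem_span_pow_of_mem_span_pow ιO hϖF hϖ hιϖ hcy)
  rcases hlvl with ⟨hn, hy⟩ | ⟨M, hMN, hn, hyM, hyM1⟩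
  · -- odd row: a representative of exact order `m ≥ N+1`
    obtain ⟨cF, m, hcy, -, hm⟩ := exists_rep_exact_order hϖF n y
    have hcF : cF ∈ Ideal.span ({πF ^ (N + 1)} : Set 𝒪[F]) := by
      have h : cF = y + (cF - y) := by ring
      rw [h]; exact Ideal.add_mem _ hy (hle (by omega) hcy)
    exact ⟨cF, m, hG cF hcy, Or.inr (Or.inr ⟨hn, (hm _).1 hcF⟩), hm⟩
  · -- even row: `c_F := y` has exact order `M`
    refine ⟨y, M, hG y (by rw [sub_self]; exact Ideal.zero_mem _), ?_, fun j' => ⟨fun h => ?_, fun h => hle h hyM⟩⟩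
    · rcases Nat.eq_zero_or_pos M with hM0 | hM1
      · exact Or.inl (by omega)
      · exact Or.inr (Or.inl ⟨hn, hM1, hMN⟩)
    · by_contra hlt
      exact hyM1 (hle (by omega) h)

end Reps

/-! ## §2 The count in the lattice-TREE currency -/

section Tree

variable {F E : Type*} [Field F] [ValuativeRel F] [Field E] [Valued E ℤᵐ⁰] [ValuativeRel E] [(Valued.v : Valuation E ℤᵐ⁰).Compatible]
  (σ : E →+* E) {K : Type*} [Field K] [Valued K ℤᵐ⁰] [ValuativeRel K] [Algebra E K] (σK : K →+* K)
  -- ★ F3-2b ∕ F3-2a's endoscopic frame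
  (hσσ : ∀ x, σ (σ x) = x) (hσK : ∀ x, σK (σK x) = x) (hσO : ∀ x : 𝒪[E], σ x ∈ 𝒪[E]) (hK2 : Module.finrank E K = 2)
  (J : GL (Fin 3) E) (hJ : J ∈ glInt 3 E) (hJh : ((J : Matrix (Fin 3) (Fin 3) E).map σ)ᵀ = J)
  (τ : Matrix (Fin 3) (Fin 3) E) {w₀ : Fin 3 → E} (hK : IsUnit (Matrix.of fun i j : Fin 3 => ((τ ^ (j : ℕ)) *ᵥ w₀) i).det)
  (φ : (E × K) →ₐ[E] Matrix (Fin 3) (Fin 3) E) (hφ : Function.Injective φ) (τB : E × K) (hτB : φ τB = τ)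
  (hstar : ∀ b : E × K, (J : Matrix (Fin 3) (Fin 3) E) * φ (RingHom.prodMap σ σK b) = ((φ b).map σ)ᵀ * J)
  -- ★ (c4)'s integral reading, and `σ_K` over `σ`
  (hOK : ∀ r : 𝒪[E], algebraMap E K (r : E) ∈ 𝒪[K]) (hσKE : ∀ x : E, σK (algebraMap E K x) = algebraMap E K (σ x))
  (jO : 𝒪[E] →+* 𝒪[K]) (hjO : ∀ x : 𝒪[E], ((jO x : 𝒪[K]) : K) = algebraMap E K x)
  (σO : 𝒪[E] →+* 𝒪[E]) (hσO' : ∀ x : 𝒪[E], ((σO x : 𝒪[E]) : E) = σ x)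
  (σKO : 𝒪[K] →+* 𝒪[K]) (hσKO : ∀ z : 𝒪[K], ((σKO z : 𝒪[K]) : K) = σK z)
  (hσv : ∀ x, valuation E (σ x) = valuation E x) (hσKv : ∀ z, valuation K (σK z) = valuation K z)
  -- ★ F3-3 ∕ F3-1a's Eisenstein letters over the inert dictionary, at `O₁ := 𝒪[K]`
  (ιO : 𝒪[F] →+* 𝒪[E]) (θ : 𝒪[K]) {aF k₀F : 𝒪[F]}
  (hσι : ∀ y, σO (ιO y) = ιO y) (hfixO : ∀ x, σO x = x → ∃ y, ιO y = x) (hιinj : Function.Injective ιO) (hιu : ∀ y, IsUnit (ιO y) → IsUnit y)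
  (htr : ∃ b₀ : 𝒪[E], b₀ + σO b₀ = 1)
  (hσ₁j : ∀ x, σKO (jO x) = jO (σO x)) (hσ₁θ : σKO θ = θ)
  (hθ : θ ^ 2 = jO (ιO aF) * θ + jO (ιO k₀F)) (haF : aF ∈ IsLocalRing.maximalIdeal 𝒪[F]) (hk₀ : k₀F ∈ IsLocalRing.maximalIdeal 𝒪[F])
  (hcoord : ∀ z : 𝒪[K], ∃! bc : 𝒪[E] × 𝒪[E], z = jO bc.1 + jO bc.2 * θ)
  (hnormE : ∀ b : 𝒪[E], IsUnit b → σO b = b → ∃ c : 𝒪[E], c * σO c = b) (hnorm₁ : ∀ z : 𝒪[K], IsUnit z → σKO z = z → ∃ w : 𝒪[K], w * σKO w = z)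
  {ϖF : F} {ϖ : E} (hϖF : IsUniformizingElement ϖF) (hϖ : IsUniformizingElement ϖ) (hιϖ : ιO ⟨ϖF, hϖF.mem⟩ = ⟨ϖ, hϖ.mem⟩)
  (hk₁ : valuation E ((ιO k₀F : 𝒪[E]) : E) = valuation E ϖ) (hq : Nat.card 𝓀[E] = Nat.card 𝓀[F] ^ 2)
  {ξ : 𝒪[E]} (hξ : IsUnit (ξ - σO ξ))
  (hnormEb : ∀ b : ℕ, 1 ≤ b → ∀ r : 𝒪[E], σO r = r → r - 1 ∈ Ideal.span ({(⟨ϖ, hϖ.mem⟩ : 𝒪[E]) ^ b} : Set 𝒪[E]) →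
    ∃ w : 𝒪[E], w - 1 ∈ Ideal.span ({(⟨ϖ, hϖ.mem⟩ : 𝒪[E]) ^ b} : Set 𝒪[E]) ∧ w * σO w = r)
  -- the `Valued` letters of ★ (c10b-S3-A) (ramified `K ∕ E`, `θ` a uniformiser, `E` unramified over `F`)
  (hσvV : ∀ x, Valued.v (σ x) = Valued.v x) (hjv : ∀ y : E, Valued.v (algebraMap E K y) = Valued.v y ^ 2)
  (hθv : Valued.v (θ : K) = WithZero.exp (-1 : ℤ)) (hϖv : Valued.v ϖ = WithZero.exp (-1 : ℤ))
  (hcoordK : ∀ z : K, ∃! pq : E × E, z = algebraMap E K pq.1 + algebraMap E K pq.2 * (θ : K))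
  (hnormK : ∀ x c : K, c ≠ 0 → σK c = c → Valued.v (x * σK x) = Valued.v c → ∃ t : K, t * σK t = c)
  -- the form's self-dual root and transitivity (★ (c2)'s letters)
  (hL₀ : IsSelfDualLattice σ ϖ (J : Matrix (Fin 3) (Fin 3) E) (stdLattice E 3))
  (htrans : ∀ M : Submodule (Valued.integer E) (Fin 3 → E), IsSelfDualLattice σ ϖ (J : Matrix (Fin 3) (Fin 3) E) M →
    ∃ u : ↥(unitaryGroupOfForm σ (J : Matrix (Fin 3) (Fin 3) E)), M = mapGL ((u : ↥(unitaryGroupOfForm σ (J : Matrix (Fin 3) (Fin 3) E))) : GL (Fin 3) E) (stdLattice E 3))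
  -- the type-(2) order `𝒪_E[x_R] = G(N, n, ιO y)` over `τ_B = incl x_R` at a MONOGENIC LEVEL (★ FILE D `exists_typeTwoOrder_of_eisensteinData`'s output letters)
  (xR : 𝒪[E] × 𝒪[K]) (hxR : RingHom.prodMap (𝒪[E]).subtype (𝒪[K]).subtype xR = τB) {N n : ℕ} {y : 𝒪[F]}
  (hR : ((Polynomial.eval₂RingHom (RingHom.prod (RingHom.id 𝒪[E]) jO) xR).range : Set (𝒪[E] × 𝒪[K])) =
    {z : 𝒪[E] × 𝒪[K] | ∃ b₀ c₀ : 𝒪[E], z.2 = jO b₀ + jO c₀ * (jO ((⟨ϖ, hϖ.mem⟩ : 𝒪[E]) ^ N) * θ) ∧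
      z.1 - (b₀ + c₀ * ιO y) ∈ Ideal.span {(⟨ϖ, hϖ.mem⟩ : 𝒪[E]) ^ n}})
  (hlvl : (n = 2 * N + 1 ∧ y ∈ Ideal.span {(⟨ϖF, hϖF.mem⟩ : 𝒪[F]) ^ (N + 1)}) ∨
    ∃ M : ℕ, M ≤ N ∧ n = 2 * M ∧ y ∈ Ideal.span {(⟨ϖF, hϖF.mem⟩ : 𝒪[F]) ^ M} ∧ y ∉ Ideal.span {(⟨ϖF, hϖF.mem⟩ : 𝒪[F]) ^ (M + 1)})
  (cls : ℕ)
  -- the PARITY GATE at a deep unitary generator (★ F3-5b-I's binder VERBATIM; F3-5b-III-β: ★ (c8)-cor at a block frame)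
  (hgate : ∀ (N'' b : ℕ) (u' p' q' t' D' : 𝒪[E]), 1 ≤ b →
    ((u', jO p' + jO q' * θ) : 𝒪[E] × 𝒪[K]) * RingHom.prodMap σO σKO (u', jO p' + jO q' * θ) = 1 →
    u' - 1 ∈ IsLocalRing.maximalIdeal 𝒪[E] → p' - 1 ∈ IsLocalRing.maximalIdeal 𝒪[E] → 1 - t' + D' ∈ IsLocalRing.maximalIdeal 𝒪[E] →
    (jO p' + jO q' * θ) ^ 2 - jO t' * (jO p' + jO q' * θ) + jO D' = 0 →
    valuation E ((q' : 𝒪[E]) : E) = valuation E ϖ ^ N'' →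
    valuation E ((u' * u' - t' * u' + D' : 𝒪[E]) : E) = valuation E ϖ ^ b →
    ((∃ w : Fin 3 → E, ∃ g ∈ unitaryGroupOfForm σ (J : Matrix (Fin 3) (Fin 3) E),
        Submodule.span 𝒪[E] ((fun x : E × K => φ x *ᵥ w) ''
          (((Polynomial.eval₂RingHom (RingHom.prod (RingHom.id 𝒪[E]) jO) ((u', jO p' + jO q' * θ) : 𝒪[E] × 𝒪[K])).range.map
            (RingHom.prodMap (𝒪[E]).subtype (𝒪[K]).subtype) : Subring (E × K)) : Set (E × K))) =
        Submodule.span 𝒪[E] (Set.range ((g : Matrix (Fin 3) (Fin 3) E))ᵀ)) ↔ b % 2 = cls))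

include hσσ hσK hσO hK2 hJ hJh hK hφ hτB hstar hOK hσKE hjO hσO' hσKO hσv hσKv hσι hfixO hιinj hιu htr hσ₁j hσ₁θ hθ haF hk₀ hcoord hnormE hnorm₁ hιϖ hk₁ hq hξ hnormEb
  hσvV hjv hθv hϖv hcoordK hnormK hL₀ htrans hxR hR hlvl hgate in
/-- **CLASS I — `#{M | IsSelfDualLattice σ ϖ J M ∧ τ·M ⊆ M} = Φ(t) = phiTHn q n N`** (TREE currency, `q = #𝓀_F`) for `τ = φ(incl x_R)` with `𝒪_E[x_R] = G(N, n, ιO y)` at a monogenic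
level, when the `E`-line `x₀ = φ(1,0)·w₀` is of class I (`∃ c ≠ 0, |σ(c)c⟨x₀,x₀⟩| = 1`) and the gate reads `b ≡ 0`.  ★ (c2) bridge + ★ F3-5b-II with `hgate₀` := ★ (S3-A) and
`hlaw ∕ hm ∕ c_F` := §1. [cite: Rogawski1990, §4.9 Lemma 4.9.3 p. 56, Prop. 4.9.1 (b) p. 55] [cite: Kottwitz1986BaseChangeUnits, §1 pp. 240–241] [cite: Flicker1998UnitaryFL, Prop. 11 p. 87; Theorem 18 p. 97] -/
theorem ncard_isSelfDualLattice_stable_eq_phiTHn [Finite 𝓀[F]] [Finite 𝓀[E]] [IsDiscreteValuationRing 𝒪[E]] [IsDiscreteValuationRing 𝒪[F]]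
    (hcls : cls = 0)
    (hI : ∃ c : E, c ≠ 0 ∧ valuation E (σ c * c *
      dotProduct (fun i => σ ((φ ((1, 0) : E × K) *ᵥ w₀) i)) ((J : Matrix (Fin 3) (Fin 3) E) *ᵥ (φ ((1, 0) : E × K) *ᵥ w₀))) = 1) :
    (({M : Submodule (Valued.integer E) (Fin 3 → E) | IsSelfDualLattice σ ϖ (J : Matrix (Fin 3) (Fin 3) E) M ∧
        M.map ((Matrix.toLin' τ).restrictScalars (Valued.integer E)) ≤ M}.ncard : ℕ) : ℚ) = phiTHn (Nat.card 𝓀[F]) n N := by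
  -- valued letters derived from the integral frame
  have hσσO : ∀ x, σO (σO x) = x := fun x => Subtype.ext (by rw [hσO', hσO', hσσ])
  have hθ' : θ * θ = jO (ιO aF) * θ + jO (ιO k₀F) := by rw [← sq]; exact hθ
  have hσKθ : σK (θ : K) = θ := by rw [← hσKO, hσ₁θ]
  have hσa : σ ((ιO aF : 𝒪[E]) : E) = ιO aF := by rw [← hσO', hσι]
  have hσk : σ ((ιO k₀F : 𝒪[E]) : E) = ιO k₀F := by rw [← hσO', hσι]
  have hσϖ : σ ϖ = ϖ := by
    have h := congrArg (fun z : 𝒪[E] => (z : E)) (hσι ⟨ϖF, hϖF.mem⟩)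
    simp only [hιϖ, hσO'] at h
    exact h
  have hθE : ∀ p q : E, algebraMap E K p + algebraMap E K q * (θ : K) = 0 → p = 0 ∧ q = 0 := by
    intro p q h
    obtain ⟨pq, -, huniq⟩ := hcoordK 0
    have h1 : (p, q) = pq := huniq (p, q) h.symm
    have h0 : ((0 : E), (0 : E)) = pq := huniq (0, 0) (by simp)
    have hpq : (p, q) = ((0 : E), (0 : E)) := h1.trans h0.symm
    exact ⟨congrArg Prod.fst hpq, congrArg Prod.snd hpq⟩
  have hkv : Valued.v ((ιO k₀F : 𝒪[E]) : E) = Valued.v ϖ := valued_v_eq_of_valuation_eq hk₁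
  have hav : Valued.v ((ιO aF : 𝒪[E]) : E) < 1 :=
    (v_lt_one_iff_valuation_lt_one _).2 (valuation_coe_lt_one_of_mem_maximalIdeal (map_k₀_mem_maximalIdeal ιO hιu haF))
  have htrE : ∃ b₀ : 𝒪[E], (b₀ : E) + σ b₀ = 1 := by
    obtain ⟨b₀, hb₀⟩ := htr
    exact ⟨b₀, by rw [← hσO', ← Subring.coe_add, hb₀]; rfl⟩
  have hnorm : ∀ v : 𝒪[E], IsUnit v → σ v = v → ∃ t : 𝒪[E], (t : E) * σ t = v := by
    intro v hv hσv'
    obtain ⟨c, hc⟩ := hnormE v hv (Subtype.ext (by rw [hσO']; exact hσv'))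
    exact ⟨c, by rw [← hσO', ← Subring.coe_mul, hc]⟩
  -- §1: the lawful representative `c_F`
  obtain ⟨cF, m, hRy, hlaw, hm⟩ := exists_lawful_rep_of_level hϖF ιO hϖ hιϖ jO θ hcoord hlvl
  rw [hRy] at hR
  -- (c2): TREE currency → SPAN currency
  rw [ncard_setOf_isSelfDualLattice_map_le_eq_ncard_setOf_span_map_le σ ϖ (J : Matrix (Fin 3) (Fin 3) E) hL₀ htrans τ]
  -- ★ F3-5b-II, with `hgate₀` := ★ (S3-A)
  exact ncard_setOf_selfDual_stable_eq_phiTHn σ σK hσσ hσK hσO hK2 J hJ hJh τ hK φ hφ τB hτB hstar hOK hσKE jO hjO σO hσO' σKO hσKO hσv hσKv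
    ιO θ hσι hfixO hιinj hιu htr hσ₁j hσ₁θ hθ haF hk₀ hcoord hnormE hnorm₁ hϖF hϖ hιϖ hk₁ hq hξ hnormEb xR hxR cF hR cls hgate
    (fun _ N'' S hS => exists_selfDual_cyclicOver_map_of_even_log σ σK hσσ hσO htrE hnorm J hJ hJh τ hK φ hφ τB hτB hstar hσvV jO hjO θ hθ' hσKE hσKθ hσa hσk
      hθE hjv hθv hϖ hϖv hσϖ hkv hav hnormK S N'' hS hI)
    hcls hI hlaw hm

omit [Valued K ℤᵐ⁰] in
include hσσ hσK hσO hK2 hJ hJh hK hφ hτB hstar hOK hσKE hjO hσO' hσKO hσv hσKv hσι hfixO hιinj hιu htr hσ₁j hσ₁θ hθ haF hk₀ hcoord hnormE hnorm₁ hιϖ hk₁ hq hξ hnormEb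
  hL₀ htrans hxR hR hlvl hgate in
/-- **CLASS II — `#{M | IsSelfDualLattice σ ϖ J M ∧ τ·M ⊆ M} = Φ′(t″) = phiTHprimen q n N`** (TREE currency) when the `E`-line is of class II (`∀ c ≠ 0, |σ(c)c⟨x₀,x₀⟩| ≠ 1`) and the
gate reads `b ≡ 1`.  ★ (c2) + ★ F3-5b-II (class II) with `hlaw ∕ hm ∕ c_F` := §1 (no product-order witness is needed). [cite: Rogawski1990, §4.9 Lemma 4.9.3 p. 56, Prop. 4.9.1 (b) p. 55]
[cite: Kottwitz1986BaseChangeUnits, §1 pp. 240–241] [cite: Flicker1998UnitaryFL, Props. 16–17 pp. 96–97; Theorem 18 p. 97] -/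
theorem ncard_isSelfDualLattice_stable_eq_phiTHprimen [Finite 𝓀[F]] [Finite 𝓀[E]] [IsDiscreteValuationRing 𝒪[E]] [IsDiscreteValuationRing 𝒪[F]]
    (hcls : cls = 1)
    (hII : ∀ c : E, c ≠ 0 → valuation E (σ c * c *
      dotProduct (fun i => σ ((φ ((1, 0) : E × K) *ᵥ w₀) i)) ((J : Matrix (Fin 3) (Fin 3) E) *ᵥ (φ ((1, 0) : E × K) *ᵥ w₀))) ≠ 1) :
    (({M : Submodule (Valued.integer E) (Fin 3 → E) | IsSelfDualLattice σ ϖ (J : Matrix (Fin 3) (Fin 3) E) M ∧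
        M.map ((Matrix.toLin' τ).restrictScalars (Valued.integer E)) ≤ M}.ncard : ℕ) : ℚ) = phiTHprimen (Nat.card 𝓀[F]) n N := by
  obtain ⟨cF, m, hRy, hlaw, hm⟩ := exists_lawful_rep_of_level hϖF ιO hϖ hιϖ jO θ hcoord hlvl
  rw [hRy] at hR
  rw [ncard_setOf_isSelfDualLattice_map_le_eq_ncard_setOf_span_map_le σ ϖ (J : Matrix (Fin 3) (Fin 3) E) hL₀ htrans τ]
  exact ncard_setOf_selfDual_stable_eq_phiTHprimen σ σK hσσ hσK hσO hK2 J hJ hJh τ hK φ hφ τB hτB hstar hOK hσKE jO hjO σO hσO' σKO hσKO hσv hσKv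
    ιO θ hσι hfixO hιinj hιu htr hσ₁j hσ₁θ hθ haF hk₀ hcoord hnormE hnorm₁ hϖF hϖ hιϖ hk₁ hq hξ hnormEb xR hxR cF hR cls hgate
    (fun h => absurd (h.symm.trans hcls) zero_ne_one) hcls hII hlaw hm

end Tree

end Literature.NumberTheory.Automorphic

end
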